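import Literature.AlgebraicGeometry.Motives.AbelianVarietyFrobeniusCharpolyOfPointCounts
import Literature.NumberTheory.GaloisRepresentations.PicardFrobeniusDegDet
import Literature.NumberTheory.GaloisRepresentations.PicardFrobeniusCharpoly
import Literature.NumberTheory.EllipticCurves.TateModuleRank
import HarnessLib

/-!
# Galois representations attached to Picard curves from the Jacobian bridge alone
# (Upton 2009 via Weil's theorem; the last door of the rigidity route)

`picardCurve_exists_lambdaAdicRep_of_jacobian` proves ALL of
`Literature.NumberTheory.GaloisRepresentations.picardCurve_exists_lambdaAdicRep` (Upton 2009, Thm. 2.1 / §4)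
from ONE geometric input, the **Jacobian bridge** `hJ`: for the curves `y^p = f(x)` over a finite field `k`
(`p ∤ deg f`, `f` separable) with Frobenius `φ` of `Ω ⊇ k` algebraically closed, an abelian variety `A/k` of
dimension `g = genus k(C_f)` together with a `φ`-equivariant additive isomorphism
`A(k̄) ≃ Pic⁰(C_{f,Ω})` — Weil's theorem that the Jacobian exists and represents `Pic⁰`
(Weil 1948; Milne, *Jacobian varieties*, Thm. 1.1, §11).

Everything else is PROVED in the tree: from `hJ`, `#A(𝔽_{q^r}) = #Pic⁰(C_Ω)^{φ^r} = ∏ᵢ (1 - αᵢ^r)` with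
`|αᵢ| = √q` (`SuperellipticFunctionField.exists_natCard_fixed_degreeZero_eq_prod` — Galois descent, F. K. Schmidt,
Hasse–Weil, all proved), hence by **Weil's theorem for abelian varieties in the tree's rigidity form**
(`AbelianVariety.exists_charpoly_frobenius_eq_prod_of_pointCount`: the theorem of the cube as an upper bound,
`p`-adic root-multiplicity rigidity, resultants and the tower argument — no intersection theory)
`charpoly (π | T_ℓ A) = ∏ᵢ (X - αᵢ)`, so `Tr(π | T_ℓ A) = ∑ αᵢ = q + 1 - N₁`; transporting along `T_ℓ` of the
bridge (`T_ℓ A ≃ T_ℓ Pic(C_Ω)`, all torsion classes having degree `0`) gives Weil's trace formula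
`Tr(φ | V_ℓ Pic) = q + 1 - #{places fixed by φ}`, i.e. the hypothesis of
`picardCurve_exists_lambdaAdicRep_of_weil`.

## References

* [Upton2009] M. Upton, *Galois representations attached to Picard curves*, J. Algebra 322 (2009), Thm. 2.1, §4.
* [Milne1986JacobianVarieties] J. S. Milne, *Jacobian varieties*, in Cornell–Silverman (1986), Thm. 1.1, §11
  Thm. 11.1.
* [Weil1948] A. Weil, *Variétés abéliennes et courbes algébriques* (1948), §IV.
* [MumfordAV1970] D. Mumford, *Abelian Varieties* (1970), §19 Thm. 4, §21.

## Design

Theorems only (D-0014/D-0026).  The bridge `hJ` is a HYPOTHESIS (binder), not a named fact: the tree's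
`AbelianVariety` library has no Jacobian with `J(k̄) = Pic⁰` in positive characteristic (`WeilJacobian*` is
`CharZero`; `Motives.Jacobian` is the Albanese universal property without points).
-/

noncomputable section

open CategoryTheory Polynomial
open scoped TensorProduct

universe u

namespace Literature.NumberTheory.GaloisRepresentations

open Literature.AlgebraicGeometry.Motives Literature.AlgebraicGeometry.Motives.AbelianVariety
  Literature.AlgebraicGeometry.Motives.AbelianVariety.Hom Literature.NumberTheory.EllipticCurves
  Literature.NumberTheory.DiophantineGeometry Literature.NumberTheory.DiophantineGeometry.AlgFunctionField

/-! ### `T_ℓ` of an embedding whose image contains the torsion is an isomorphism -/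

section TateTransport

variable {G H : Type*} [AddCommGroup G] [AddCommGroup H] (ℓ : ℕ) [Fact ℓ.Prime]

/-- **`T_ℓ` of an injective additive map whose image contains all `ℓ`-power torsion is bijective.**
[folklore] -/
theorem tateModule_map_bijective_of_injective (i : G →+ H) (hinj : Function.Injective i)
    (htors : ∀ (n : ℕ) (h : H), ℓ ^ n • h = 0 → h ∈ Set.range i) :
    Function.Bijective (TateModule.map ℓ i) := by
  constructor
  · intro x y hxy
    refine TateModule.ext fun n => hinj ?_
    have := congrArg (TateModule.proj ℓ n) hxy
    rwa [TateModule.proj_map, TateModule.proj_map] at this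
  · intro y
    have hy : ∀ n, ∃ g : G, i g = TateModule.proj ℓ n y := fun n =>
      htors n _ (TateModule.pow_smul_proj n y)
    choose g hg using hy
    refine ⟨TateModule.mk g (fun n => hinj ?_) (fun n => hinj ?_), TateModule.ext fun n => ?_⟩
    · rw [map_nsmul, hg, map_zero, TateModule.pow_smul_proj]
    · rw [map_nsmul, hg, hg, TateModule.smul_proj_succ]
    · rw [TateModule.proj_map, TateModule.proj_mk, hg]

end TateTransport

/-- `(1 - X^r)(g) a = 0 ↔ g^r a = a` for an additive endomorphism `g`. [folklore] -/
theorem aeval_one_sub_X_pow_apply_eq_zero_iff {M : Type*} [AddCommGroup M] (g : AddMonoid.End M) (r : ℕ) (a : M) :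
    (aeval g (1 - Polynomial.X ^ r : ℤ[X])) a = 0 ↔ (⇑g)^[r] a = a := by
  rw [map_sub, map_one, map_pow, aeval_X, ← AddMonoid.End.coe_pow,
    show ((1 - g ^ r : AddMonoid.End M)) a = a - (g ^ r) a from rfl, sub_eq_zero]
  exact ⟨fun h => h.symm, fun h => h.symm⟩

/-! ### The door -/

/-- **Galois representations attached to Picard curves (Upton 2009, Thm. 2.1 / §4) from the Jacobian bridge.**
Hypothesis `hJ` (Weil 1948; Milne, *Jacobian varieties*, Thm. 1.1 and §11): for every curve `y^p = f(x)` over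
a finite field `k` (`p ∤ deg f`, `f` separable), `Ω ⊇ k` algebraically closed and algebraic with Frobenius
`φ` (`φ x = x^{#k}`), there are an abelian variety `A/k` of dimension `genus k(C_f)` and an additive
isomorphism `e : A(k̄) ≃ Pic⁰(C_{f,Ω})` with `e (π a) = φ • e a` for the Frobenius endomorphism `π` of `A`.
Conclusion: `picardCurve_exists_lambdaAdicRep` (all clauses), through Weil's theorem for `A` in the tree's
rigidity form and `picardCurve_exists_lambdaAdicRep_of_weil`.
[cite: Upton2009, Thm. 2.1 and §4] [cite: Milne1986JacobianVarieties, Thm. 1.1 and §11 Thm. 11.1]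
[cite: MumfordAV1970, §19 Thm. 4 and §21] -/
theorem picardCurve_exists_lambdaAdicRep_of_jacobian
    (hJ : ∀ (k : Type) [Field k] [Fintype k] (Ω : Type) [Field Ω] [Algebra k Ω] [IsAlgClosed Ω]
      [Algebra.IsAlgebraic k Ω] (p : ℕ) [Fact p.Prime] (f : k[X]),
      (p : k) ≠ 0 → f.Separable → ¬ p ∣ f.natDegree →
      ∀ [Fact (Irreducible (superellipticPoly k Ω p f))] [Fact (Irreducible (superellipticPoly k k p f))]
        (φ : Ω ≃ₐ[k] Ω), (∀ x : Ω, φ x = x ^ Fintype.card k) →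
        ∃ (A : AbelianVariety.{0} k) (e : A.geomPoints ≃+ SuperellipticPic.degreeZero k Ω p f),
          A.dim = genus k (SuperellipticFunctionField k k p f) ∧
          ∀ a : A.geomPoints, ((e (geomPointsMap (frobeniusHom A) a) : SuperellipticPic.degreeZero k Ω p f) :
            SuperellipticPic k Ω p f) = φ • ((e a : SuperellipticPic.degreeZero k Ω p f) : SuperellipticPic k Ω p f)) :
    picardCurve_exists_lambdaAdicRep := by
  classical
  refine picardCurve_exists_lambdaAdicRep_of_weil fun k _ _ Ω _ _ _ _ p _ ℓ _ f hpk hℓk hsep hndvd _ φ hφ => ?_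
  have hdeg : 0 < f.natDegree := Nat.pos_of_ne_zero fun h => hndvd (by rw [h]; exact dvd_zero p)
  haveI : Fact (Irreducible (superellipticPoly k k p f)) := fact_irreducible_superellipticPoly k k f hsep hdeg
  obtain ⟨A, e, hdim, hequiv⟩ := hJ k Ω p f hpk hsep hndvd φ hφ
  obtain ⟨α, hαn, hαN, hh⟩ :=
    SuperellipticFunctionField.exists_natCard_fixed_degreeZero_eq_prod (Ω := Ω) φ hφ hpk hsep hndvd
  -- notation
  set Pic := SuperellipticPic k Ω p f with hPic
  set π : A.geomPoints →+ A.geomPoints := geomPointsMap (frobeniusHom A) with hπ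
  set i : A.geomPoints →+ Pic := (SuperellipticPic.degreeZero k Ω p f).subtype.comp e.toAddMonoidHom with hi
  have hi_apply : ∀ a, i a = ((e a : SuperellipticPic.degreeZero k Ω p f) : Pic) := fun a => rfl
  have hinj : Function.Injective i := fun a b h => e.injective (Subtype.ext h)
  have hiπ : ∀ a, i (π a) = φ • i a := fun a => hequiv a
  have hiπ_iter : ∀ (m : ℕ) (a : A.geomPoints), i (π^[m] a) = (φ ^ m) • i a := by
    intro m
    induction m with
    | zero => intro a; simp
    | succ m ih => intro a; rw [Function.iterate_succ_apply', hiπ, ih, pow_succ', mul_smul]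
  -- torsion classes have degree `0`, hence lie in the image of `i`
  have htors : ∀ (n : ℕ) (c : Pic), ℓ ^ n • c = 0 → c ∈ Set.range i := by
    intro n c hc
    have hdeg0 : SuperellipticPic.degree k Ω p f c = 0 := by
      have h1 := congrArg (SuperellipticPic.degree k Ω p f) hc
      rw [map_nsmul, map_zero, nsmul_eq_mul] at h1
      exact (mul_eq_zero.mp h1).resolve_left (by exact_mod_cast pow_ne_zero n (Fact.out : ℓ.Prime).ne_zero)
    refine ⟨e.symm ⟨c, hdeg0⟩, ?_⟩
    rw [hi_apply, AddEquiv.apply_symm_apply]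
  -- the characteristic `p₀` of `k`, and `ℓ ≠ p₀`
  set p₀ := ringChar k with hp₀
  haveI hp₀prime : Fact p₀.Prime := ⟨CharP.char_is_prime k p₀⟩
  have hℓp₀ : ℓ ≠ p₀ := by
    intro h
    apply hℓk
    rw [h, hp₀]
    exact ringChar.Nat.cast_ringChar
  -- `#A[ℓ^n] = ℓ^{2 dim A · n}` and `#Pic[ℓ^n]` likewise (transport along `i`)
  have hcardA : ∀ n : ℕ, Nat.card (AddSubgroup.torsionBy A.geomPoints (ℓ ^ n : ℕ)) = ℓ ^ ((2 * A.dim) * n) :=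
    natCard_geomTorsion_pow_tate (A := A) ℓ hℓk
  haveI hfreeA : Module.Free ℤ_[ℓ] (A.tateModule ℓ) := TateModule.free_of_card_torsionBy_rank hcardA
  haveI hfinA : Module.Finite ℤ_[ℓ] (A.tateModule ℓ) := TateModule.finite_of_card_torsionBy_rank hcardA
  -- `T_ℓ(i)` is a linear isomorphism intertwining `T_ℓ(π)` and `φ`
  set T := TateModule.map ℓ i with hT
  have hTbij : Function.Bijective T := tateModule_map_bijective_of_injective ℓ i hinj htors
  set E : A.tateModule ℓ ≃ₗ[ℤ_[ℓ]] TateModule Pic ℓ := LinearEquiv.ofBijective T hTbij with hE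
  have hE_apply : ∀ x, E x = T x := fun x => rfl
  haveI hfreeP : Module.Free ℤ_[ℓ] (TateModule Pic ℓ) := Module.Free.of_equiv E
  haveI hfinP : Module.Finite ℤ_[ℓ] (TateModule Pic ℓ) := Module.Finite.equiv E
  have hinter : ∀ x : A.tateModule ℓ,
      E (tateModuleMap ℓ (frobeniusHom A) x) = tateRepresentation (Ω ≃ₐ[k] Ω) Pic ℓ φ (E x) := by
    intro x
    rw [tateRepresentation_apply_apply, hE_apply, hE_apply]
    refine TateModule.ext fun n => ?_
    rw [hT, TateModule.proj_map, proj_tateModuleMap, TateModule.proj_smul_of_distribMulAction,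
      TateModule.proj_map]
    exact hiπ _
  have hconj : tateRepresentation (Ω ≃ₐ[k] Ω) Pic ℓ φ = E.conj (tateModuleMap ℓ (frobeniusHom A)) := by
    refine LinearMap.ext fun y => ?_
    rw [LinearEquiv.conj_apply_apply, hinter, LinearEquiv.apply_symm_apply]
  -- the trace on `V_ℓ Pic` is the trace of `T_ℓ(π)`
  have htrace : LinearMap.trace ℚ_[ℓ] (RationalTateModule Pic ℓ)
      (rationalTateRepresentation (Ω ≃ₐ[k] Ω) Pic ℓ φ) =
      algebraMap ℤ_[ℓ] ℚ_[ℓ] (LinearMap.trace ℤ_[ℓ] (A.tateModule ℓ) (tateModuleMap ℓ (frobeniusHom A))) := by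
    have h1 : rationalTateRepresentation (Ω ≃ₐ[k] Ω) Pic ℓ φ =
        (tateRepresentation (Ω ≃ₐ[k] Ω) Pic ℓ φ).baseChange ℚ_[ℓ] := by
      rfl
    rw [h1]
    change LinearMap.trace ℚ_[ℓ] (ℚ_[ℓ] ⊗[ℤ_[ℓ]] TateModule Pic ℓ) _ = _
    rw [LinearMap.trace_baseChange, hconj, LinearMap.trace_conj']
  -- the trace of `T_ℓ(π)` is `q + 1 - N₁`
  have hq1 : (1 : ℝ) < √(Fintype.card k : ℝ) := by
    rw [show (1 : ℝ) = √1 from Real.sqrt_one.symm]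
    exact Real.sqrt_lt_sqrt zero_le_one (by exact_mod_cast Fintype.one_lt_card)
  have htraceA : LinearMap.trace ℤ_[ℓ] (A.tateModule ℓ) (tateModuleMap ℓ (frobeniusHom A)) =
      (((Fintype.card k : ℤ) + 1 - (pointCount k (SuperellipticFunctionField k k p f) 1 : ℤ) : ℤ) : ℤ_[ℓ]) := by
    rcases Nat.eq_zero_or_pos A.dim with hA0 | hApos
    · -- genus `0`: `T_ℓ A = 0` and `N₁ = q + 1`
      have hcard0 : ∀ n : ℕ, Nat.card (AddSubgroup.torsionBy A.geomPoints (ℓ ^ n : ℕ)) = ℓ ^ (0 * n) := by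
        intro n; rw [hcardA n, hA0]
      obtain ⟨e0⟩ := TateModule.nonempty_linearEquiv_of_card_torsionBy hcard0
      haveI : Subsingleton (A.tateModule ℓ) := e0.toEquiv.subsingleton
      have h0 : tateModuleMap ℓ (frobeniusHom A) = 0 := Subsingleton.elim _ _
      rw [h0, map_zero]
      have h1 := hαN 1 Nat.one_pos
      have hg0 : 2 * genus k (SuperellipticFunctionField k k p f) = 0 := by rw [← hdim, hA0]
      have hsum : ∑ i, α i ^ 1 = 0 :=
        Finset.sum_eq_zero fun i _ => absurd i.2 (by omega)
      rw [hsum, sub_zero, pow_one] at h1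
      have h2 : ((Fintype.card k : ℤ) + 1 - (pointCount k (SuperellipticFunctionField k k p f) 1 : ℤ) : ℤ) = 0 := by
        have h3 : ((pointCount k (SuperellipticFunctionField k k p f) 1 : ℤ) : ℂ) = ((Fintype.card k : ℤ) + 1 : ℤ) := by
          push_cast; exact h1
        have h4 := Int.cast_injective (α := ℂ) h3
        omega
      rw [h2, Int.cast_zero]
    · -- genus `> 0`: Weil's theorem for `A` in the rigidity form
      haveI : CharP k p₀ := ringChar.charP k
      -- the point counts of `A` are those of `Pic⁰`
      have hpt : ∀ r : ℕ, 0 < r →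
          ((Literature.AlgebraicGeometry.Motives.pointCount A.X r : ℕ) : ℂ) = ∏ i, (1 - α i ^ r) := by
        intro r hr
        rw [← hh r hr, pointCount_eq_natCard_kerPoints, ← natCard_setOf_geomPointsMap_eq_zero]
        congr 1
        refine Nat.card_congr ?_
        have hker : ∀ a : A.geomPoints,
            geomPointsMap ((1 - End.of (frobeniusHom A) ^ r : End A) : A ⟶ A) a = 0 ↔ π^[r] a = a := by
          intro a
          rw [one_sub_frobeniusHom_pow_eq_aeval, geomPointsMap_aeval]
          exact aeval_one_sub_X_pow_apply_eq_zero_iff π r a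
        refine
          { toFun := fun a => ⟨i a.1, (e a.1).2, ?_⟩
            invFun := fun c => ⟨e.symm ⟨c.1, c.2.1⟩, ?_⟩
            left_inv := fun a => ?_
            right_inv := fun c => ?_ }
        · rw [← hiπ_iter, (hker a.1).mp a.2]
        · rw [hker]
          apply hinj
          rw [hiπ_iter, hi_apply, AddEquiv.apply_symm_apply]
          exact c.2.2
        · exact Subtype.ext (e.symm_apply_eq.mpr (Subtype.ext (hi_apply a.1)))
        · exact Subtype.ext (by simp [hi_apply])
      obtain ⟨P, hPm, -, hPC, hchar⟩ :=
        exists_charpoly_frobenius_eq_prod_of_pointCount A hApos p₀ hq1 hαn hpt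
      rw [LinearMap.trace_eq_neg_charpoly_nextCoeff, hchar ℓ hℓp₀, nextCoeff_map Int.cast_injective]
      -- `nextCoeff P = -∑ αᵢ = -(q + 1 - N₁)`
      have hnext : ((P.nextCoeff : ℤ) : ℂ) = -∑ i, α i := by
        have h1 : (P.map (algebraMap ℤ ℂ)).nextCoeff = ((P.nextCoeff : ℤ) : ℂ) := by
          rw [nextCoeff_map (algebraMap ℤ ℂ).injective_int]; simp
        rw [← h1, hPC, prod_X_sub_C_nextCoeff]
      have h2 := hαN 1 Nat.one_pos
      simp only [pow_one] at h2
      have h3 : ((P.nextCoeff : ℤ) : ℂ) =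
          ((-((Fintype.card k : ℤ) + 1 - (pointCount k (SuperellipticFunctionField k k p f) 1 : ℤ)) : ℤ) : ℂ) := by
        rw [hnext]; push_cast; linear_combination (-1 : ℂ) * h2
      have h4 := Int.cast_injective (α := ℂ) h3
      rw [h4, eq_intCast]
      push_cast
      ring
  rw [htrace, htraceA, ← SuperellipticFunctionField.natCard_fixedPlaces_frobenius_eq_pointCount_one φ hφ hpk hsep hndvd]
  simp

end Literature.NumberTheory.GaloisRepresentations

end
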